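import Mathlib.Topology.Covering.Basic
import Mathlib.Topology.Homotopy.Lifting
import Mathlib.Topology.IsLocalHomeomorph
import Mathlib.Analysis.Normed.Module.Basic
import Mathlib.Analysis.Normed.Module.FiniteDimension
import HarnessLib

/-!
# Resolving a sign ambiguity over a simply connected space (the two-sheeted sign cover)

Topic `Literature/Topology/FourManifolds` (fact seat
`provefact-Literature.Topology.FourManifolds.exists_homeomorph_image_eq_sphereEquator`: Brown's
generalized Schoenflies theorem for *locally flat* spheres; this file is the covering-space input
for the two-sidedness of a locally flat codimension-one sphere).  **Everything here is proved.**

The classical fact behind the two-sidedness of hypersurfaces in simply connected manifolds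
(Rushing, *Topological Embeddings* (1973), §1.7, "two-sided", and Thm. 1.7.5; Hirsch,
*Differential Topology*, Ch. 4, Thm. 4.6; Hatcher, *Algebraic Topology* (2002), Prop. 1.33 and
§3.3, Prop. 3.25 for the analogous orientation cover) is a lifting statement: a quantity that is
locally well defined *up to sign* on a simply connected, locally path connected space is globally
well defined up to one sign.  We prove it in the following elementary form.

Let `S` be a compact Hausdorff, simply connected, locally path connected space, `K ⊆ S` a closed
set with empty interior, and `F : S → (A → ℝ)` (`A` finite) a bounded function which is
continuous and nowhere zero on `S ∖ K` and which near every point of `K` is *continuous up to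
sign*: on an open neighbourhood `W` one has `F = ε • g` off `K` with `g` continuous and nowhere
zero on `W` and `ε = ±1`.  Then there is a sign function `χ : S → {±1}`, continuous on `S ∖ K`,
such that for every such local datum `(W, g, ε)` with `W` preconnected the product `χ • ε` is
constant on `W ∖ K` (`Literature.Topology.FourManifolds.exists_sign_resolution`).

*Proof.*  The **sign cover** `E = closure {(z, ±F z) | z ∉ K} ⊆ S × ℝᴬ`
(`Literature.Topology.FourManifolds.signCover`) meets `W × ℝᴬ` in the two disjoint graphs of
`±g` (`signCover_inter_prod_eq`), so the first projection `E → S` is a local homeomorphism of a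
compact Hausdorff space, hence a covering map (Mathlib `isLocalHomeomorph_iff_isCoveringMap`);
the identity of `S` lifts to a continuous section (Mathlib
`IsCoveringMap.existsUnique_continuousMap_lifts`, the lifting criterion Hatcher Prop. 1.33),
i.e. a continuous `G` with `G = ±F` off `K` and `G = ±g` on each `W`; `χ = G/F`.

Used in `LocallyFlatTwoSided.lean`: for a locally flat codimension-one closed set the local side
indicators of the flattening charts assemble into such an `F`, and `χ` is a coherent global
choice of side.

## References

* T. B. Rushing, *Topological Embeddings*, Academic Press (1973), §1.7 (two-sidedness,
  Thm. 1.7.5). [Rushing1973]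
* A. Hatcher, *Algebraic Topology*, CUP (2002), Prop. 1.33 (lifting criterion), Prop. 3.25.
  [HatcherAT2002]
-/

noncomputable section

open Set Function Filter Metric
open scoped _root_.Topology

namespace Literature.Topology.FourManifolds

variable {S : Type*} [TopologicalSpace S] {A : Type*}

/-! ### Signs -/

/-- Two signs `κ, κ' ∈ {±1}` with `‖κ' • g - κ • g‖ < ‖g‖` are equal. [folklore] -/
theorem sign_eq_of_norm_sub_lt {V : Type*} [NormedAddCommGroup V] [NormedSpace ℝ V] {g : V}
    {κ κ' : ℝ} (hκ : κ = 1 ∨ κ = -1) (hκ' : κ' = 1 ∨ κ' = -1)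
    (h : ‖κ' • g - κ • g‖ < ‖g‖) : κ' = κ := by
  by_contra hne
  have hκ'' : κ' = -κ := by
    rcases hκ with rfl | rfl <;> rcases hκ' with rfl | rfl <;> first | exact (hne rfl).elim | norm_num
  rw [hκ'', ← sub_smul, norm_smul, show -κ - κ = -2 * κ by ring, norm_mul, norm_neg,
    Real.norm_two, show ‖κ‖ = 1 by rcases hκ with rfl | rfl <;> simp] at h
  linarith [norm_nonneg g]

/-- If `v = ε • g` with `ε = ±1` then `v = g ∨ v = -g`. [folklore] -/
theorem eq_or_eq_neg_of_eq_sign_smul {V : Type*} [AddCommGroup V] [Module ℝ V] {v g : V} {ε : ℝ}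
    (hε : ε = 1 ∨ ε = -1) (h : v = ε • g) : v = g ∨ v = -g := by
  rcases hε with rfl | rfl
  · exact Or.inl (by simpa using h)
  · exact Or.inr (by simpa using h)

/-! ### The sign cover -/

/-- The **sign cover** of a function `F : S → ℝᴬ` across a set `K`: the closure in `S × ℝᴬ` of the
two graphs `{(z, F z)}`, `{(z, -F z)}` over `S ∖ K`.  When `F` is continuous up to sign near `K`
(and continuous off `K`) this is a two-sheeted covering space of `S`
(`isCoveringMap_signCover_fst`). [folklore] -/
def signCover (K : Set S) (F : S → A → ℝ) : Set (S × (A → ℝ)) :=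
  closure {p | p.1 ∉ K ∧ (p.2 = F p.1 ∨ p.2 = -F p.1)}

/-- The sign cover is closed. [folklore] -/
theorem isClosed_signCover (K : Set S) (F : S → A → ℝ) : IsClosed (signCover K F) :=
  isClosed_closure

/-- A **local sign datum** for `F` across `K` on `W`: `g` is continuous and nowhere zero on `W` and
`F = ε • g` on `W ∖ K` with `ε = ±1` there. [folklore] -/
structure IsLocalSignDatum (K : Set S) (F : S → A → ℝ) (W : Set S) (g : S → A → ℝ) (ε : S → ℝ) :
    Prop where
  /-- `W` is open. -/
  isOpen : IsOpen W
  /-- `g` is continuous on `W`. -/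
  continuousOn : ContinuousOn g W
  /-- `g` does not vanish on `W`. -/
  ne_zero : ∀ z ∈ W, g z ≠ 0
  /-- `ε` is a sign on `W ∖ K`. -/
  sign : ∀ z ∈ W \ K, ε z = 1 ∨ ε z = -1
  /-- `F = ε • g` on `W ∖ K`. -/
  eq_smul : ∀ z ∈ W \ K, F z = ε z • g z

namespace IsLocalSignDatum

variable {K W : Set S} {F g : S → A → ℝ} {ε : S → ℝ}

/-- Off `K`, the values of `F` are `±g`. [folklore] -/
theorem eq_or_eq_neg (h : IsLocalSignDatum K F W g ε) {z : S} (hz : z ∈ W \ K) :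
    F z = g z ∨ F z = -g z :=
  eq_or_eq_neg_of_eq_sign_smul (h.sign z hz) (h.eq_smul z hz)

/-- Off `K`, the values of `g` are `±F`. [folklore] -/
theorem eq_or_eq_neg' (h : IsLocalSignDatum K F W g ε) {z : S} (hz : z ∈ W \ K) :
    g z = F z ∨ g z = -F z := by
  rcases h.eq_or_eq_neg hz with h1 | h1
  · exact Or.inl h1.symm
  · exact Or.inr (by rw [h1, neg_neg])

/-- Restriction of a local sign datum to a smaller open set. [folklore] -/
theorem mono (h : IsLocalSignDatum K F W g ε) {W' : Set S} (hW' : IsOpen W') (hsub : W' ⊆ W) :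
    IsLocalSignDatum K F W' g ε where
  isOpen := hW'
  continuousOn := h.continuousOn.mono hsub
  ne_zero z hz := h.ne_zero z (hsub hz)
  sign z hz := h.sign z ⟨hsub hz.1, hz.2⟩
  eq_smul z hz := h.eq_smul z ⟨hsub hz.1, hz.2⟩

end IsLocalSignDatum

/-- The trivial local sign datum off `K`: `F` itself with `ε = 1`, when `F` is continuous and
nowhere zero on the open set `S ∖ K`. [folklore] -/
theorem isLocalSignDatum_compl {K : Set S} {F : S → A → ℝ} (hK : IsClosed K)
    (hF : ContinuousOn F Kᶜ) (hF0 : ∀ z ∉ K, F z ≠ 0) :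
    IsLocalSignDatum K F Kᶜ F (fun _ => 1) where
  isOpen := hK.isOpen_compl
  continuousOn := hF
  ne_zero z hz := hF0 z hz
  sign _ _ := Or.inl rfl
  eq_smul z _ := by simp

section LocalStructure

variable {K W : Set S} {F g : S → A → ℝ} {ε : S → ℝ}

/-- If `K` has empty interior, every point of `W ∩ K` (`W` open) is a limit of points of `W ∖ K`.
[folklore] -/
theorem subset_closure_diff_of_interior_eq_empty (hK : interior K = ∅) (hW : IsOpen W) :
    W ⊆ closure (W \ K) := by
  intro z hz
  rw [mem_closure_iff_nhds]
  intro U hU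
  by_contra hne
  rw [not_nonempty_iff_eq_empty] at hne
  have hsub : U ∩ W ⊆ K := by
    intro y hy
    by_contra hyK
    have : y ∈ U ∩ (W \ K) := ⟨hy.1, hy.2, hyK⟩
    rw [hne] at this
    exact this
  have : z ∈ interior K := mem_interior_iff_mem_nhds.2 (mem_of_superset (inter_mem hU (hW.mem_nhds hz)) hsub)
  rw [hK] at this
  exact this

/-- **Local structure of the sign cover.**  Over an open set `W` carrying a local sign datum
`(g, ε)`, and provided `K` has empty interior, the sign cover is exactly the union of the two
graphs of `g` and `-g` over `W`. [folklore] -/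
theorem signCover_inter_prod_eq (hK : interior K = ∅) (h : IsLocalSignDatum K F W g ε) :
    signCover K F ∩ W ×ˢ univ = {p | p.1 ∈ W ∧ (p.2 = g p.1 ∨ p.2 = -g p.1)} := by
  classical
  set D : Set (S × (A → ℝ)) := {p | p.1 ∉ K ∧ (p.2 = F p.1 ∨ p.2 = -F p.1)} with hD
  have hcl : signCover K F = closure D := rfl
  apply Subset.antisymm
  · -- `⊆`: the closure of `D` inside `W × ℝᴬ` lies in the (relatively closed) union of graphs
    rintro p ⟨hp, hpW, -⟩
    refine ⟨hpW, ?_⟩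
    -- `p ∈ closure (D ∩ W ×ˢ univ)`
    have hp' : p ∈ closure ((W ×ˢ univ) ∩ D) :=
      (h.isOpen.prod isOpen_univ).inter_closure ⟨⟨hpW, mem_univ _⟩, hcl ▸ hp⟩
    -- `D ∩ W ×ˢ univ ⊆ G₊ ∪ G₋`
    have hsub : (W ×ˢ univ) ∩ D ⊆ {q | q.1 ∈ W ∧ q.2 = g q.1} ∪ {q | q.1 ∈ W ∧ q.2 = -g q.1} := by
      rintro q ⟨⟨hqW, -⟩, hqK, hq⟩
      rcases h.eq_or_eq_neg ⟨hqW, hqK⟩ with h1 | h1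
      · rcases hq with hq | hq
        · exact Or.inl ⟨hqW, by rw [hq, h1]⟩
        · exact Or.inr ⟨hqW, by rw [hq, h1]⟩
      · rcases hq with hq | hq
        · exact Or.inr ⟨hqW, by rw [hq, h1]⟩
        · exact Or.inl ⟨hqW, by rw [hq, h1, neg_neg]⟩
    have hp'' := closure_mono hsub hp'
    rw [closure_union] at hp''
    -- continuity of `g` at `p.1`
    have hgc : ContinuousAt g p.1 := h.continuousOn.continuousAt (h.isOpen.mem_nhds hpW)
    rcases hp'' with hp'' | hp''
    · left
      have hc : ContinuousAt (fun q : S × (A → ℝ) => q.2 - g q.1) p :=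
        continuousAt_snd.sub (hgc.comp_of_eq continuousAt_fst rfl)
      have := hc.continuousWithinAt.mem_closure_image hp''
      have himg : (fun q : S × (A → ℝ) => q.2 - g q.1) '' {q | q.1 ∈ W ∧ q.2 = g q.1} ⊆ {0} := by
        rintro _ ⟨q, ⟨-, hq⟩, rfl⟩
        simp [hq]
      have := closure_mono himg this
      rw [closure_singleton, mem_singleton_iff, sub_eq_zero] at this
      exact this
    · right
      have hc : ContinuousAt (fun q : S × (A → ℝ) => q.2 + g q.1) p :=
        continuousAt_snd.add (hgc.comp_of_eq continuousAt_fst rfl)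
      have := hc.continuousWithinAt.mem_closure_image hp''
      have himg : (fun q : S × (A → ℝ) => q.2 + g q.1) '' {q | q.1 ∈ W ∧ q.2 = -g q.1} ⊆ {0} := by
        rintro _ ⟨q, ⟨-, hq⟩, rfl⟩
        simp [hq]
      have := closure_mono himg this
      rw [closure_singleton, mem_singleton_iff, add_eq_zero_iff_eq_neg] at this
      exact this
  · -- `⊇`: the graphs of `±g` over `W` lie in the closure of `D`
    rintro p ⟨hpW, hp⟩
    refine ⟨?_, by simpa [mem_prod] using hpW⟩
    -- the sign `κ` of the sheet through `p`
    obtain ⟨κ, hκ, hpκ⟩ : ∃ κ : ℝ, (κ = 1 ∨ κ = -1) ∧ p.2 = κ • g p.1 := by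
      rcases hp with hp | hp
      · exact ⟨1, Or.inl rfl, by simp [hp]⟩
      · exact ⟨-1, Or.inr rfl, by simp [hp]⟩
    -- the section `z ↦ (z, κ • g z)` is continuous at `p.1` and maps `W ∖ K` into `D`
    have hgc : ContinuousAt g p.1 := h.continuousOn.continuousAt (h.isOpen.mem_nhds hpW)
    have hψ : ContinuousAt (fun z : S => (z, κ • g z)) p.1 :=
      continuousAt_id.prodMk (hgc.const_smul κ)
    have hmem : p.1 ∈ closure (W \ K) := subset_closure_diff_of_interior_eq_empty hK h.isOpen hpW
    have := hψ.continuousWithinAt.mem_closure_image hmem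
    have hp_eq : p = (p.1, κ • g p.1) := Prod.ext rfl hpκ
    rw [hcl, hp_eq]
    refine closure_mono ?_ this
    rintro _ ⟨z, hz, rfl⟩
    refine ⟨hz.2, ?_⟩
    rcases h.eq_or_eq_neg' hz with h1 | h1
    · rcases hκ with rfl | rfl
      · exact Or.inl (by simp [h1])
      · exact Or.inr (by simp [h1])
    · rcases hκ with rfl | rfl
      · exact Or.inr (by simp [h1])
      · exact Or.inl (by simp [h1])

/-- On a local sign datum, a point of the sign cover over `W` lies on one of the two sheets.
[folklore] -/
theorem exists_sign_of_mem_signCover (hK : interior K = ∅) (h : IsLocalSignDatum K F W g ε)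
    {p : S × (A → ℝ)} (hp : p ∈ signCover K F) (hpW : p.1 ∈ W) :
    ∃ κ : ℝ, (κ = 1 ∨ κ = -1) ∧ p.2 = κ • g p.1 := by
  have : p ∈ signCover K F ∩ W ×ˢ univ := ⟨hp, by simp [mem_prod, hpW]⟩
  rw [signCover_inter_prod_eq hK h] at this
  rcases this.2 with h1 | h1
  · exact ⟨1, Or.inl rfl, by simp [h1]⟩
  · exact ⟨-1, Or.inr rfl, by simp [h1]⟩

/-- Conversely the two sheets over `W` lie in the sign cover. [folklore] -/
theorem mk_mem_signCover (hK : interior K = ∅) (h : IsLocalSignDatum K F W g ε) {z : S}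
    (hz : z ∈ W) {κ : ℝ} (hκ : κ = 1 ∨ κ = -1) : (z, κ • g z) ∈ signCover K F := by
  have : (z, κ • g z) ∈ signCover K F ∩ W ×ˢ univ := by
    rw [signCover_inter_prod_eq hK h]
    rcases hκ with rfl | rfl
    · exact ⟨hz, Or.inl (by simp)⟩
    · exact ⟨hz, Or.inr (by simp)⟩
  exact this.1

end LocalStructure

/-! ### The sign cover is a covering space -/

section Covering

variable [Fintype A] {K : Set S} {F : S → A → ℝ}

/-- The sign cover of a bounded function over a compact space is compact. [folklore] -/
theorem isCompact_signCover [CompactSpace S] (K : Set S) {F : S → A → ℝ} {C : ℝ}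
    (hC : ∀ z, ‖F z‖ ≤ C) : IsCompact (signCover K F) := by
  have hsub : signCover K F ⊆ univ ×ˢ closedBall (0 : A → ℝ) C := by
    refine closure_minimal ?_ (isClosed_univ.prod isClosed_closedBall)
    rintro p ⟨-, hp⟩
    refine ⟨mem_univ _, ?_⟩
    rw [mem_closedBall, dist_zero_right]
    rcases hp with hp | hp
    · rw [hp]; exact hC _
    · rw [hp, norm_neg]; exact hC _
  exact (isCompact_univ.prod (isCompact_closedBall _ _)).of_isClosed_subset
    (isClosed_signCover K F) hsub

/-- The hypotheses of the sign-resolution theorem, bundled: `K` is closed with empty interior,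
`F` is bounded, continuous and nowhere zero off `K`, and admits a local sign datum about every
point of `K`. [folklore] -/
structure IsSignAmbiguous (K : Set S) (F : S → A → ℝ) : Prop where
  /-- `K` is closed. -/
  isClosed : IsClosed K
  /-- `K` has empty interior. -/
  interior_eq : interior K = ∅
  /-- `F` is bounded. -/
  bounded : ∃ C, ∀ z, ‖F z‖ ≤ C
  /-- `F` is continuous off `K`. -/
  continuousOn : ContinuousOn F Kᶜ
  /-- `F` is nowhere zero off `K`. -/
  ne_zero : ∀ z ∉ K, F z ≠ 0
  /-- Near every point of `K` there is a local sign datum. -/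
  exists_datum : ∀ z ∈ K, ∃ W g ε, z ∈ W ∧ IsLocalSignDatum K F W g ε

namespace IsSignAmbiguous

/-- Every point of `S` carries a local sign datum. [folklore] -/
theorem exists_datum' (h : IsSignAmbiguous K F) (z : S) :
    ∃ W g ε, z ∈ W ∧ IsLocalSignDatum K F W g ε := by
  by_cases hz : z ∈ K
  · exact h.exists_datum z hz
  · exact ⟨Kᶜ, F, fun _ => 1, hz, isLocalSignDatum_compl h.isClosed h.continuousOn h.ne_zero⟩

/-- **The sign cover is a covering space**: for a sign-ambiguous `F` on a compact Hausdorff space,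
the first projection `signCover K F → S` is a covering map (a local homeomorphism of a compact
Hausdorff space, Mathlib `isLocalHomeomorph_iff_isCoveringMap`). [folklore] -/
theorem isCoveringMap_fst [T2Space S] [CompactSpace S] (h : IsSignAmbiguous K F) :
    IsCoveringMap (fun p : signCover K F => p.1.1) := by
  classical
  obtain ⟨C, hC⟩ := h.bounded
  haveI : CompactSpace (signCover K F) := isCompact_iff_compactSpace.1 (isCompact_signCover K hC)
  rw [← isLocalHomeomorph_iff_isCoveringMap, isLocalHomeomorph_iff_isOpenEmbedding_restrict]
  intro e
  obtain ⟨W, g, ε, heW, hd⟩ := h.exists_datum' e.1.1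
  obtain ⟨κ, hκ, heκ⟩ := exists_sign_of_mem_signCover h.interior_eq hd e.2 heW
  -- the sheet through `e`
  set U : Set (signCover K F) := {q | q.1.1 ∈ W ∧ ‖q.1.2 - κ • g q.1.1‖ < ‖g q.1.1‖} with hU
  -- points of the sheet
  have hsheet : ∀ q ∈ U, q.1.2 = κ • g q.1.1 := by
    intro q hq
    obtain ⟨κ', hκ', hq'⟩ := exists_sign_of_mem_signCover h.interior_eq hd q.2 hq.1
    have := sign_eq_of_norm_sub_lt (g := g q.1.1) hκ hκ' (by rw [← hq']; exact hq.2)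
    rw [hq', this]
  -- `U` is open
  have hUopen : IsOpen U := by
    have hc : ContinuousOn (fun q : signCover K F => ‖g q.1.1‖ - ‖q.1.2 - κ • g q.1.1‖)
        {q | q.1.1 ∈ W} := by
      have hg : ContinuousOn (fun q : signCover K F => g q.1.1) {q | q.1.1 ∈ W} :=
        hd.continuousOn.comp (continuous_fst.comp continuous_subtype_val).continuousOn
          (fun q hq => hq)
      exact hg.norm.sub (((continuous_snd.comp continuous_subtype_val).continuousOn.sub
        (hg.const_smul κ)).norm)
    have hopen : IsOpen {q : signCover K F | q.1.1 ∈ W} :=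
      hd.isOpen.preimage (continuous_fst.comp continuous_subtype_val)
    have := hc.isOpen_inter_preimage hopen (isOpen_Ioi (a := (0 : ℝ)))
    convert this using 1
    ext q
    simp only [hU, mem_setOf_eq, mem_inter_iff, mem_preimage, mem_Ioi, sub_pos]
  have heU : e ∈ U := by
    refine ⟨heW, ?_⟩
    rw [heκ, sub_self, norm_zero, norm_pos_iff]
    exact hd.ne_zero _ heW
  refine ⟨U, hUopen.mem_nhds heU, ?_⟩
  -- the sheet is homeomorphic to `W` by the projection
  have hmemE : ∀ z ∈ W, (z, κ • g z) ∈ signCover K F := fun z hz =>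
    mk_mem_signCover h.interior_eq hd hz hκ
  have hmemU : ∀ (z : S) (hz : z ∈ W), (⟨(z, κ • g z), hmemE z hz⟩ : signCover K F) ∈ U := by
    intro z hz
    refine ⟨hz, ?_⟩
    change ‖κ • g z - κ • g z‖ < ‖g z‖
    rw [sub_self, norm_zero, norm_pos_iff]
    exact hd.ne_zero z hz
  let φ : U ≃ₜ W :=
    { toFun := fun q => ⟨q.1.1.1, q.2.1⟩
      invFun := fun w => ⟨⟨(w.1, κ • g w.1), hmemE w.1 w.2⟩, hmemU w.1 w.2⟩
      left_inv := by
        rintro ⟨⟨⟨z, v⟩, hqE⟩, hqU⟩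
        have hv : v = κ • g z := hsheet _ hqU
        subst hv
        rfl
      right_inv := fun w => rfl
      continuous_toFun := by
        refine Continuous.subtype_mk ?_ _
        exact continuous_fst.comp (continuous_subtype_val.comp continuous_subtype_val)
      continuous_invFun := by
        refine Continuous.subtype_mk (Continuous.subtype_mk ?_ _) _
        refine continuous_subtype_val.prodMk ?_
        exact ((hd.continuousOn.const_smul κ).comp_continuous continuous_subtype_val
          (fun w => w.2)) }
  have hcomp : U.restrict (fun p : signCover K F => p.1.1) = ((↑) : W → S) ∘ φ := by
    funext q
    rfl
  rw [hcomp]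
  exact (hd.isOpen.isOpenEmbedding_subtypeVal).comp φ.isOpenEmbedding

end IsSignAmbiguous

end Covering

/-! ### The section and the global sign -/

section Resolution

variable [Fintype A] {K : Set S} {F : S → A → ℝ}

/-- On a preconnected open set, a continuous function which is pointwise `±g` (`g` continuous and
nowhere zero) is `κ • g` for one constant sign `κ`. [folklore] -/
theorem exists_const_sign_of_isPreconnected {W : Set S} {G g : S → A → ℝ} (hW : IsPreconnected W)
    (hWo : IsOpen W) (hG : ContinuousOn G W) (hg : ContinuousOn g W) (hg0 : ∀ z ∈ W, g z ≠ 0)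
    (hpt : ∀ z ∈ W, ∃ κ : ℝ, (κ = 1 ∨ κ = -1) ∧ G z = κ • g z) :
    ∃ κ : ℝ, (κ = 1 ∨ κ = -1) ∧ ∀ z ∈ W, G z = κ • g z := by
  -- the two relatively open pieces
  set P : ℝ → Set S := fun κ => W ∩ {z | ‖G z - κ • g z‖ < ‖g z‖} with hP
  have hopen : ∀ κ : ℝ, IsOpen (P κ) := by
    intro κ
    have hc : ContinuousOn (fun z => ‖g z‖ - ‖G z - κ • g z‖) W :=
      hg.norm.sub ((hG.sub (hg.const_smul κ)).norm)
    have := hc.isOpen_inter_preimage hWo (isOpen_Ioi (a := (0 : ℝ)))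
    convert this using 1
    ext z
    simp only [hP, mem_inter_iff, mem_setOf_eq, mem_preimage, mem_Ioi, sub_pos]
  have hmem_iff : ∀ κ : ℝ, (κ = 1 ∨ κ = -1) → ∀ z ∈ W, (z ∈ P κ ↔ G z = κ • g z) := by
    intro κ hκ z hz
    constructor
    · rintro ⟨-, hlt⟩
      obtain ⟨κ', hκ', hz'⟩ := hpt z hz
      simp only [mem_setOf_eq] at hlt
      rw [hz'] at hlt ⊢
      rw [sign_eq_of_norm_sub_lt hκ hκ' hlt]
    · intro hz'
      refine ⟨hz, ?_⟩
      change ‖G z - κ • g z‖ < ‖g z‖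
      rw [hz', sub_self, norm_zero, norm_pos_iff]
      exact hg0 z hz
  have hcov : W ⊆ P 1 ∪ P (-1) := by
    intro z hz
    obtain ⟨κ, hκ, hzκ⟩ := hpt z hz
    rcases hκ with rfl | rfl
    · exact Or.inl ((hmem_iff 1 (Or.inl rfl) z hz).2 hzκ)
    · exact Or.inr ((hmem_iff (-1) (Or.inr rfl) z hz).2 hzκ)
  by_cases hW1 : (W ∩ P 1).Nonempty
  · by_cases hW2 : (W ∩ P (-1)).Nonempty
    · -- both sheets are met: contradiction with preconnectedness
      exfalso
      obtain ⟨z, hzW, hz1, hz2⟩ := hW (P 1) (P (-1)) (hopen 1) (hopen (-1)) hcov hW1 hW2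
      have h1 := (hmem_iff 1 (Or.inl rfl) z hzW).1 hz1
      have h2 := (hmem_iff (-1) (Or.inr rfl) z hzW).1 hz2
      rw [h1, one_smul, neg_one_smul, eq_neg_iff_add_eq_zero, ← two_smul ℝ] at h2
      exact hg0 z hzW (by simpa using h2)
    · refine ⟨1, Or.inl rfl, fun z hz => ?_⟩
      rcases hcov hz with h1 | h1
      · exact (hmem_iff 1 (Or.inl rfl) z hz).1 h1
      · exact (hW2 ⟨z, hz, h1⟩).elim
  · refine ⟨-1, Or.inr rfl, fun z hz => ?_⟩
    rcases hcov hz with h1 | h1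
    · exact (hW1 ⟨z, hz, h1⟩).elim
    · exact (hmem_iff (-1) (Or.inr rfl) z hz).1 h1

/-- A sign `χ = ±1` relating two continuous nowhere-zero functions `G = χ • F` on an open set is
continuous there (it is locally constant). [folklore] -/
theorem continuousOn_sign_of_eq_smul {U : Set S} {G F : S → A → ℝ} {χ : S → ℝ} (hU : IsOpen U)
    (hG : ContinuousOn G U) (hF : ContinuousOn F U) (hF0 : ∀ z ∈ U, F z ≠ 0)
    (hχ : ∀ z ∈ U, χ z = 1 ∨ χ z = -1) (hGF : ∀ z ∈ U, G z = χ z • F z) : ContinuousOn χ U := by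
  intro z hz
  have hopen : IsOpen (U ∩ {y | ‖G y - χ z • F y‖ < ‖F y‖}) := by
    have hc : ContinuousOn (fun y => ‖F y‖ - ‖G y - χ z • F y‖) U :=
      hF.norm.sub ((hG.sub (hF.const_smul (χ z))).norm)
    have := hc.isOpen_inter_preimage hU (isOpen_Ioi (a := (0 : ℝ)))
    convert this using 1
    ext y
    simp only [mem_inter_iff, mem_setOf_eq, mem_preimage, mem_Ioi, sub_pos]
  have hzmem : z ∈ U ∩ {y | ‖G y - χ z • F y‖ < ‖F y‖} := by
    refine ⟨hz, ?_⟩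
    change ‖G z - χ z • F z‖ < ‖F z‖
    rw [hGF z hz, sub_self, norm_zero, norm_pos_iff]
    exact hF0 z hz
  apply (continuousWithinAt_const (b := χ z)).congr_of_eventuallyEq _ rfl
  filter_upwards [mem_nhdsWithin_of_mem_nhds (hopen.mem_nhds hzmem)] with y hy
  have hy' : ‖χ y • F y - χ z • F y‖ < ‖F y‖ := by
    have := hy.2
    simp only [mem_setOf_eq] at this
    rwa [hGF y hy.1] at this
  exact sign_eq_of_norm_sub_lt (hχ z hz) (hχ y hy.1) hy'

/-- **Resolution of a sign ambiguity over a simply connected space.**  Let `S` be compact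
Hausdorff, simply connected and locally path connected, `K ⊆ S` closed with empty interior, and
`F : S → ℝᴬ` sign-ambiguous across `K` (`IsSignAmbiguous`: bounded, continuous and nowhere zero
off `K`, and `= ε • g` with `g` continuous nonvanishing and `ε = ±1` near each point of `K`).
Then there is `χ : S → ℝ` with values `±1` and continuous on `S ∖ K` such that for every local
sign datum `(W, g, ε)` with `W` preconnected, `χ • ε` is constant (`= ±1`) on `W ∖ K`.
(The identity of `S` lifts through the two-sheeted sign cover: Hatcher 2002, Prop. 1.33; this is
the covering-space form of "a hypersurface of a simply connected manifold is two-sided",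
Rushing 1973, §1.7.) [cite: HatcherAT2002, Prop. 1.33] -/
theorem exists_sign_resolution [T2Space S] [CompactSpace S] [SimplyConnectedSpace S]
    [LocallyPathConnectedSpace S] (h : IsSignAmbiguous K F) :
    ∃ χ : S → ℝ, (∀ z, χ z = 1 ∨ χ z = -1) ∧ ContinuousOn χ Kᶜ ∧
      ∀ W g ε, IsLocalSignDatum K F W g ε → IsPreconnected W →
        ∃ κ : ℝ, (κ = 1 ∨ κ = -1) ∧ ∀ z ∈ W \ K, χ z * ε z = κ := by
  classical
  cases isEmpty_or_nonempty S with
  | inl hS =>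
    exact ⟨fun _ => 1, fun z => (IsEmpty.false z).elim, fun z => (IsEmpty.false z).elim,
      fun W g ε _ _ => ⟨1, Or.inl rfl, fun z => (IsEmpty.false z).elim⟩⟩
  | inr hS =>
  -- a base point off `K`
  obtain ⟨a₀, ha₀⟩ : (Kᶜ : Set S).Nonempty := by
    rw [nonempty_compl]
    intro hK
    have := h.interior_eq
    rw [hK, interior_univ] at this
    exact univ_nonempty.ne_empty this
  have he₀ : (a₀, F a₀) ∈ signCover K F := subset_closure ⟨ha₀, Or.inl rfl⟩
  -- the section
  obtain ⟨σ, ⟨-, hσ⟩, -⟩ := h.isCoveringMap_fst.existsUnique_continuousMap_lifts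
    (ContinuousMap.id S) a₀ ⟨(a₀, F a₀), he₀⟩ rfl
  have hσ1 : ∀ z, (σ z).1.1 = z := fun z => congrFun hσ z
  set G : S → A → ℝ := fun z => (σ z).1.2 with hG
  have hGc : Continuous G := continuous_snd.comp (continuous_subtype_val.comp σ.continuous)
  have hGmem : ∀ z, (z, G z) ∈ signCover K F := by
    intro z
    have := (σ z).2
    rwa [show (σ z).1 = (z, G z) from Prod.ext (hσ1 z) rfl] at this
  -- off `K`, `G = ±F`; the global sign
  have hoff : ∀ z ∉ K, ∃ κ : ℝ, (κ = 1 ∨ κ = -1) ∧ G z = κ • F z := fun z hz =>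
    exists_sign_of_mem_signCover h.interior_eq
      (isLocalSignDatum_compl h.isClosed h.continuousOn h.ne_zero) (hGmem z) hz
  choose! χ hχ hχG using hoff
  -- make `χ` total with values `±1`
  set χ' : S → ℝ := fun z => if z ∈ K then 1 else χ z with hχ'
  have hχ'eq : ∀ z ∉ K, χ' z = χ z := fun z hz => by simp [hχ', hz]
  refine ⟨χ', fun z => ?_, ?_, ?_⟩
  · by_cases hz : z ∈ K
    · simp [hχ', hz]
    · rw [hχ'eq z hz]; exact hχ z hz
  · refine (continuousOn_sign_of_eq_smul h.isClosed.isOpen_compl hGc.continuousOn h.continuousOn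
      h.ne_zero hχ hχG).congr ?_
    intro z hz
    exact hχ'eq z hz
  · intro W g ε hd hW
    have hpt : ∀ z ∈ W, ∃ κ : ℝ, (κ = 1 ∨ κ = -1) ∧ G z = κ • g z := fun z hz =>
      exists_sign_of_mem_signCover h.interior_eq hd (hGmem z) hz
    obtain ⟨κ, hκ, hκG⟩ := exists_const_sign_of_isPreconnected hW hd.isOpen hGc.continuousOn
      hd.continuousOn hd.ne_zero hpt
    refine ⟨κ, hκ, fun z hz => ?_⟩
    rw [hχ'eq z hz.2]
    have h1 : G z = (χ z * ε z) • g z := by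
      rw [hχG z hz.2, hd.eq_smul z hz, smul_smul]
    have h2 : (χ z * ε z - κ) • g z = 0 := by
      rw [sub_smul, ← h1, hκG z hz.1, sub_self]
    by_contra hne
    have hne' : χ z * ε z - κ ≠ 0 := sub_ne_zero.2 hne
    have := congrArg (fun v => (χ z * ε z - κ)⁻¹ • v) h2
    simp only [smul_smul, inv_mul_cancel₀ hne', one_smul, smul_zero] at this
    exact hd.ne_zero z hz.1 this

end Resolution

end Literature.Topology.FourManifolds
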